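import Mathlib
import HarnessLib
import Literature.Probability.Percolation.TwoPointFunction
import Literature.Probability.Percolation.BondPercolationSymmetry
import Literature.Probability.LatticeModels.LatticeGraphProofs
import Summits.CriticalPhenomena.PercolationContinuityZ3.Theorems.PercTreeValueTetrahedronDisjointCoexistenceStubPairSymm
import Summits.CriticalPhenomena.PercolationContinuityZ3.Theorems.PercTreeValueTetrahedronHarrisGapStubG

/-!
# `stub_crossedPairSymmetry` of line `SketchIdeator1` (crux `PercTreeValue.TetrahedronHarrisGap`,
# stmt-CriticalPhenomena-7799, skeleton rev 7)

Registered stub `stub_crossedPairSymmetry`, landed DEF-FREE over tree declarations.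

With the vertices `0`, `a_r = (r,r,0)`, `b_r = (r,0,r)`, `c_r = (0,r,r)` of the lattice tetrahedron
`T_r ⊂ ℤ³` and `P = bondPercolation (zdGraph 3) p`:

* `P({0 ↔ a_r} ∩ {b_r ↔ c_r}) = P({0 ↔ b_r} ∩ {a_r ↔ c_r})`,
* `τ_p(0, b_r) = τ_p(0, a_r)`,
* `τ_p(a_r, c_r) = τ_p(0, a_r)`.

Proof. The coordinate swap `σ(x) = (x₀, x₂, x₁)` is an automorphism of the nearest-neighbour
graph `ℤ³` (it permutes coordinates, so it preserves the `ℓ¹`-distance,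
`zdGraph_adj_iff_norm_holds`) with `σ 0 = 0`, `σ a_r = b_r`, `σ b_r = a_r`, `σ c_r = c_r`. Bond
percolation is invariant under graph automorphisms (`bondPercolation_real_preimage_relabel_iso`:
`P {ω | σ '' ω ∈ S} = P(S)`), and `{ω | σ '' ω ∈ {σ x ↔ σ y}} = {x ↔ y}`
(`pairSymm_preimage_relabel_openConn`), so pulling back `{0 ↔ b_r} ∩ {a_r ↔ c_r}` along
`ω ↦ σ '' ω` gives `{0 ↔ a_r} ∩ {b_r ↔ c_r}` (first item) and `τ_p(σ 0, σ a_r) = τ_p(0, a_r)`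
(`tau_iso`, second item). The third item is `tau_opposite_edge_eq` composed with `σ`:
`τ_p(a_r, c_r) = τ_p(σ b_r, σ c_r) = τ_p(b_r, c_r) = τ_p(0, a_r)`.
-/

noncomputable section

namespace Summit.CriticalPhenomena.PercolationContinuityZ3.Theorems.TetrahedronHarrisGap

open MeasureTheory
open Literature.Probability.Percolation Literature.Probability.LatticeModels
open Summit.CriticalPhenomena.PercolationContinuityZ3.Theorems.TetrahedronDisjointCoexistence
  (pairSymm_preimage_relabel_openConn)

/-- **Crossed-pair symmetry of the lattice tetrahedron.** With `a_r = (r,r,0)`, `b_r = (r,0,r)`,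
`c_r = (0,r,r)` and `P = bondPercolation (zdGraph 3) p`:
`P({0 ↔ a_r} ∩ {b_r ↔ c_r}) = P({0 ↔ b_r} ∩ {a_r ↔ c_r})`, `τ_p(0, b_r) = τ_p(0, a_r)` and
`τ_p(a_r, c_r) = τ_p(0, a_r)`, by the coordinate swap `σ(x) = (x₀, x₂, x₁)` (a lattice automorphism
with `σ 0 = 0`, `σ a_r = b_r`, `σ b_r = a_r`, `σ c_r = c_r`), the automorphism invariance of bond
percolation (`bondPercolation_real_preimage_relabel_iso`, `tau_iso`) and `tau_opposite_edge_eq`. -/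
theorem stub_crossedPairSymmetry :
    ∀ (p : unitInterval) (r : ℕ),
      (bondPercolation (zdGraph 3) p).real
          (openConn (0 : Site 3) ![(r : ℤ), (r : ℤ), 0] ∩ openConn (![(r : ℤ), 0, (r : ℤ)] : Site 3) ![0, (r : ℤ), (r : ℤ)]) =
        (bondPercolation (zdGraph 3) p).real
          (openConn (0 : Site 3) ![(r : ℤ), 0, (r : ℤ)] ∩ openConn (![(r : ℤ), (r : ℤ), 0] : Site 3) ![0, (r : ℤ), (r : ℤ)]) ∧
      tau 3 p 0 ![(r : ℤ), 0, (r : ℤ)] = tau 3 p 0 ![(r : ℤ), (r : ℤ), 0] ∧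
      tau 3 p ![(r : ℤ), (r : ℤ), 0] ![0, (r : ℤ), (r : ℤ)] = tau 3 p 0 ![(r : ℤ), (r : ℤ), 0] := by
  intro p r
  -- `ℓ¹` characterisation of adjacency in `ℤ³`
  have hadj : ∀ x y : Site 3, (zdGraph 3).Adj x y ↔ ∑ i, |x i - y i| = 1 :=
    zdGraph_adj_iff_norm_holds
  -- the coordinate swap `σ(x) = (x₀, x₂, x₁)`, an (involutive) automorphism of `ℤ³`
  let σ : zdGraph 3 ≃g zdGraph 3 :=
    { toFun := fun x => ![x 0, x 2, x 1]
      invFun := fun y => ![y 0, y 2, y 1]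
      left_inv := fun x => by
        funext i
        fin_cases i <;> simp
      right_inv := fun y => by
        funext i
        fin_cases i <;> simp
      map_rel_iff' := fun {a b} => by
        simp only [Equiv.coe_fn_mk, hadj, Fin.sum_univ_three, Matrix.cons_val_zero,
          Matrix.cons_val_one, Matrix.head_cons, Matrix.cons_val_two, Matrix.tail_cons]
        constructor <;> intro h <;> linarith }
  have hσ : ∀ x : Site 3, σ x = ![x 0, x 2, x 1] := fun x => rfl
  have hσ0 : σ 0 = 0 := by
    rw [hσ]
    funext i
    fin_cases i <;> simp
  have hσa : σ ![(r : ℤ), (r : ℤ), 0] = ![(r : ℤ), 0, (r : ℤ)] := by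
    rw [hσ]
    funext i
    fin_cases i <;> simp
  have hσb : σ ![(r : ℤ), 0, (r : ℤ)] = ![(r : ℤ), (r : ℤ), 0] := by
    rw [hσ]
    funext i
    fin_cases i <;> simp
  have hσc : σ ![0, (r : ℤ), (r : ℤ)] = ![0, (r : ℤ), (r : ℤ)] := by
    rw [hσ]
    funext i
    fin_cases i <;> simp
  refine ⟨?_, ?_, ?_⟩
  · -- pull `{0 ↔ b_r} ∩ {a_r ↔ c_r}` back along `ω ↦ σ '' ω`
    have h1 := pairSymm_preimage_relabel_openConn σ.toEquiv (0 : Site 3) ![(r : ℤ), (r : ℤ), 0]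
    have h2 :=
      pairSymm_preimage_relabel_openConn σ.toEquiv (![(r : ℤ), 0, (r : ℤ)] : Site 3) ![0, (r : ℤ), (r : ℤ)]
    rw [RelIso.coe_fn_toEquiv, hσ0, hσa] at h1
    rw [RelIso.coe_fn_toEquiv, hσb, hσc] at h2
    rw [← h1, ← h2, ← Set.preimage_inter]
    exact bondPercolation_real_preimage_relabel_iso σ p _
  · -- `τ(σ 0, σ a_r) = τ(0, a_r)`
    have h3 := tau_iso σ p 0 ![(r : ℤ), (r : ℤ), 0]
    rwa [hσ0, hσa] at h3
  · -- `τ(a_r, c_r) = τ(σ b_r, σ c_r) = τ(b_r, c_r) = τ(0, a_r)`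
    have h4 := tau_iso σ p ![(r : ℤ), 0, (r : ℤ)] ![0, (r : ℤ), (r : ℤ)]
    rw [hσb, hσc] at h4
    rw [h4]
    exact tau_opposite_edge_eq p r
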